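/-
Copyright (c) 2026. All rights reserved.
Released under Apache 2.0 license as described in the file LICENSE.
Authors: abc-iut cell, prover seat abc-iut-w4-d017 (wave 4, gen 5).
-/
import Literature.IUT.LogVolume.UnitLogWildQuadraticDyadic
import Literature.IUT.LogVolume.PadicSubfields
import HarnessLib

/-!
# Wild quadratic dyadic fields (`e = 2`, `f = 1` over `ℚ₂`): the three cases of `log₂(𝒪_K^×)`

Proof-only sequel (theorems, no definitions) of `UnitLogWildQuadraticDyadic.lean` (same seat): for a complete
ultrametric normed `ℚ₂`-algebra field `K` with `e = 2`, `f = 1`, uniformizer `ϖ` (`‖ϖ‖² = ‖2‖`), `log₂(𝒪_K^×) =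
𝔪³ ∪ (λ + 𝔪³)`, `λ = log₂ u₀` for ANY `u₀ ∈ U_1 ∖ U_2`.  Here (classical, Neukirch ANT II (5.5); no IUT statement asserted):

* §7 the TRICHOTOMY on `‖λ‖`: `‖λ‖ ≤ ‖ϖ‖³ ⇒ log₂(𝒪^×) = 𝔪³` (`logUnits_eq_closedBall_of_norm_unitLog_le`);
  `‖λ‖ = ‖ϖ‖² ⇒ log₂(𝒪^×) = 𝔪² = 2𝒪` (`logUnits_eq_closedBall_of_norm_unitLog_eq_sq`); `‖λ‖ = ‖ϖ‖ ⇒ log₂(𝒪^×)`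
  is NOT an `𝒪_K`-submodule (`mul_unitLog_not_mem_logUnits`), is no ball (`logUnits_ne_closedBall`,
  **`closedBall_ne_zpow_smul_logUnits`**: `{‖y‖ ≤ ‖t‖} ≠ 2^k·log₂(𝒪^×)` for all `t`, `k`), and its unit stabiliser
  is EXACTLY `U_2 = 1 + 2𝒪` (**`smul_logUnits_eq_iff`**);
* §8 EVALUATION of `λ` at square roots `ρ² = a`, `a ∈ ℚ₂` ⊆ `K`: `‖log₂ ρ‖ = 4·‖1 − a²‖` whenever `‖1 − a²‖ ≤ 1/8`
  (`ρ⁴ = a²` in the contraction range); `‖1 − a‖ = 1/2 ⇒ ‖1 − ρ‖ = ‖ϖ‖` (`ρ ∈ U_1 ∖ U_2`); and for `‖a‖ = 1/2`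
  (`ρ` a uniformizer), **`‖log₂(1 + ρ)‖ = ‖ϖ‖`** (`(1 + ρ)² = 1 − 2w` with `‖w‖ = 1`, `‖1 + w‖ = ‖ϖ‖`);
* §9 the three cases: **`‖a‖ = 1/2`** (`ℚ₂(√±2)`, `ℚ₂(√±6)`; abc-iut-w5-d039's hand value `log₂(1 + √2) ≡ √2
  (mod 𝔪²)`): `closedBall_ne_zpow_smul_logUnits_of_norm_eq_half` (NO ball is a `2^k·log₂(𝒪^×)`),
  `smul_logUnits_eq_iff_of_norm_eq_half` (unit stabiliser `1 + 2𝒪`), `one_add_smul_logUnits_ne_of_norm_eq_half`;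
  **`‖1 − a‖ = 1/2, ‖1 + a‖ = 1/4`** (`ℚ₂(√3)`): `logUnits_eq_closedBall_norm_two_of_sq_eq` (`= 2𝒪 = 𝔪²`);
  **`‖1 − a‖ = 1/2, ‖1 + a‖ ≤ 1/8`** (`ℚ₂(√−1)`): `logUnits_eq_closedBall_cube_of_sq_eq` (`= 𝔪³`).

Consumer: the abc-iut cell's TEAM R «ismDH mover» thread (`Thm311RealIsmDHMoverCriterion`: `t·𝒪_v` is fixed by all
of Dupuy–Hilado's (Ind2) iff it is a `p^k·log_p(𝒪_v^×)`; `Thm311RealIsmDHUnramifiedDyadicUnits` for unit multiples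
`w·I_v`) — the `e = 2`, `f = 1` cell of the over-`2` column. [cite: NeukirchANT1999, Ch. II Prop. (5.5)]
-/

noncomputable section

open Metric Set IsLocalRing
open scoped Pointwise

namespace Literature.IUT.LogVolume

namespace WildQuadraticDyadic

open Literature.NumberTheory.GaloisRepresentations.Ultrametric

variable {K : Type*} [NontriviallyNormedField K] [NormedAlgebra ℚ_[2] K]

/-! ## 7. The trichotomy on `‖λ‖`, `λ = log₂ u₀` -/

section Trichotomy

variable [IsUltrametricDist K] [CompleteSpace K] [ProperSpace K] {ϖ : Kˣ} (hϖ : IsUniformizer ϖ)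
include hϖ

/-- **Case `‖λ‖ ≤ ‖ϖ‖³` (e.g. `ℚ₂(√−1)`): `log₂(𝒪_K^×) = 𝔪³`.** [cite: NeukirchANT1999, Ch. II Prop. (5.5)] -/
theorem logUnits_eq_closedBall_of_norm_unitLog_le (he : absRamificationIdx 2 K = 2) (hf : residueDegree 2 K = 1)
    {u₀ : K} (hu₀ : ‖1 - u₀‖ = ‖(ϖ : K)‖) (hlam : ‖unitLog u₀‖ ≤ ‖(ϖ : K)‖ ^ 3) :
    logUnits K = closedBall (0 : K) (‖(ϖ : K)‖ ^ 3) := by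
  rw [logUnits_eq_union hϖ he hf hu₀]
  refine union_eq_left.mpr fun z hz => ?_
  rw [mem_closedBall, dist_eq_norm] at hz
  rw [mem_closedBall_zero_iff, show z = (z - unitLog u₀) + unitLog u₀ by ring]
  exact (IsUltrametricDist.norm_add_le_max _ _).trans (max_le hz hlam)

/-- **Case `‖λ‖ = ‖ϖ‖²` (e.g. `ℚ₂(√3)`): `log₂(𝒪_K^×) = 𝔪² = 2𝒪_K`.** [cite: NeukirchANT1999, Ch. II Prop. (5.5)] -/
theorem logUnits_eq_closedBall_of_norm_unitLog_eq_sq (he : absRamificationIdx 2 K = 2)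
    (hf : residueDegree 2 K = 1) {u₀ : K} (hu₀ : ‖1 - u₀‖ = ‖(ϖ : K)‖) (hlam : ‖unitLog u₀‖ = ‖(ϖ : K)‖ ^ 2) :
    logUnits K = closedBall (0 : K) (‖(ϖ : K)‖ ^ 2) := by
  have h32 : ‖(ϖ : K)‖ ^ 3 ≤ ‖(ϖ : K)‖ ^ 2 := by
    rw [pow_succ]; exact mul_le_of_le_one_right (by positivity) hϖ.1.le
  have hlam0 : unitLog u₀ ≠ 0 := norm_pos_iff.mp (by rw [hlam]; exact pow_pos (norm_units_pos ϖ) 2)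
  rw [logUnits_eq_union hϖ he hf hu₀]
  refine Subset.antisymm (union_subset (closedBall_subset_closedBall h32) fun z hz => ?_) fun z hz => ?_
  · rw [mem_closedBall, dist_eq_norm] at hz
    rw [mem_closedBall_zero_iff, show z = (z - unitLog u₀) + unitLog u₀ by ring]
    exact (IsUltrametricDist.norm_add_le_max _ _).trans (max_le (hz.trans h32) hlam.le)
  · rw [mem_closedBall_zero_iff] at hz
    rcases hz.lt_or_eq with hlt | heq
    · exact Or.inl (mem_closedBall_zero_iff.mpr (norm_le_cube_of_norm_lt_sq hϖ hlt))
    · right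
      rw [mem_closedBall, dist_eq_norm, ← norm_neg, neg_sub]
      calc ‖unitLog u₀ - z‖ ≤ ‖(ϖ : K)‖ * ‖unitLog u₀‖ :=
            norm_sub_le_unif_mul_of_norm_eq hϖ hf hlam0 (by rw [heq, hlam])
        _ = ‖(ϖ : K)‖ ^ 3 := by rw [hlam]; ring

/-- **Case `‖λ‖ = ‖ϖ‖` (e.g. `ℚ₂(√±2)`, `ℚ₂(√±6)`): `w·λ ∉ log₂(𝒪_K^×)` for every `w ∈ U_1 ∖ U_2`** — so
`log₂(𝒪_K^×)` is NOT an `𝒪_K`-submodule of `K`. [cite: NeukirchANT1999, Ch. II Prop. (5.5)] -/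
theorem mul_unitLog_not_mem_logUnits (he : absRamificationIdx 2 K = 2) (hf : residueDegree 2 K = 1) {u₀ : K}
    (hu₀ : ‖1 - u₀‖ = ‖(ϖ : K)‖) (hlam : ‖unitLog u₀‖ = ‖(ϖ : K)‖) {w : K} (hw : ‖1 - w‖ = ‖(ϖ : K)‖) :
    w * unitLog u₀ ∉ logUnits K := by
  have hw1 : ‖w‖ = 1 := IsPrincipal.norm_eq_one (show ‖1 - w‖ < 1 by rw [hw]; exact hϖ.1)
  have hlt3 : ‖(ϖ : K)‖ ^ 3 < ‖(ϖ : K)‖ := by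
    rw [norm_unif_pow_three hϖ he]
    have := norm_units_pos ϖ
    nlinarith
  have hlt32 : ‖(ϖ : K)‖ ^ 3 < ‖(ϖ : K)‖ ^ 2 := by
    rw [pow_succ]; exact mul_lt_of_lt_one_right (pow_pos (norm_units_pos ϖ) 2) hϖ.1
  rw [mem_logUnits_iff_norm hϖ he hf hu₀, norm_mul, hw1, one_mul, hlam,
    show w * unitLog u₀ - unitLog u₀ = -((1 - w) * unitLog u₀) by ring, norm_neg, norm_mul, hw, hlam, ← sq]
  push Not
  exact ⟨hlt3, hlt32⟩

/-- **Case `‖λ‖ = ‖ϖ‖`: the unit stabiliser of `log₂(𝒪_K^×)` is EXACTLY `U_2 = 1 + 2𝒪_K`**: for `‖w‖ = 1`,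
`w · log₂(𝒪_K^×) = log₂(𝒪_K^×) ↔ ‖1 − w‖ ≤ ‖ϖ‖²`. [cite: NeukirchANT1999, Ch. II Prop. (5.5)] -/
theorem smul_logUnits_eq_iff (he : absRamificationIdx 2 K = 2) (hf : residueDegree 2 K = 1) {u₀ : K}
    (hu₀ : ‖1 - u₀‖ = ‖(ϖ : K)‖) (hlam : ‖unitLog u₀‖ = ‖(ϖ : K)‖) {w : K} (hw : ‖w‖ = 1) :
    w • logUnits K = logUnits K ↔ ‖1 - w‖ ≤ ‖(ϖ : K)‖ ^ 2 := by
  refine ⟨fun h => ?_, smul_logUnits_eq_of_norm_one_sub_le hϖ he hf⟩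
  rcases norm_one_sub_le_sq_or_eq hϖ hf hw with hle | heq
  · exact hle
  · exfalso
    have hu₀1 : ‖u₀‖ = 1 := IsPrincipal.norm_eq_one (show ‖1 - u₀‖ < 1 by rw [hu₀]; exact hϖ.1)
    have hmem : w * unitLog u₀ ∈ w • logUnits K := smul_mem_smul_set (unitLog_mem_logUnits hu₀1)
    rw [h] at hmem
    exact mul_unitLog_not_mem_logUnits hϖ he hf hu₀ hlam heq hmem

/-- **Case `‖λ‖ = ‖ϖ‖`: `log₂(𝒪_K^×)` is NOT a ball `{‖y‖ ≤ r}`** (a ball containing `λ` contains `u₀·λ`).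
[cite: NeukirchANT1999, Ch. II Prop. (5.5)] -/
theorem logUnits_ne_closedBall (he : absRamificationIdx 2 K = 2) (hf : residueDegree 2 K = 1) {u₀ : K}
    (hu₀ : ‖1 - u₀‖ = ‖(ϖ : K)‖) (hlam : ‖unitLog u₀‖ = ‖(ϖ : K)‖) (r : ℝ) :
    logUnits K ≠ closedBall (0 : K) r := by
  intro h
  have hu₀1 : ‖u₀‖ = 1 := IsPrincipal.norm_eq_one (show ‖1 - u₀‖ < 1 by rw [hu₀]; exact hϖ.1)
  have h1 : unitLog u₀ ∈ closedBall (0 : K) r := h ▸ unitLog_mem_logUnits hu₀1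
  have h2 : u₀ * unitLog u₀ ∈ closedBall (0 : K) r := by
    rw [mem_closedBall_zero_iff] at h1 ⊢
    rwa [norm_mul, hu₀1, one_mul]
  rw [← h] at h2
  exact mul_unitLog_not_mem_logUnits hϖ he hf hu₀ hlam hu₀ h2

/-- **Case `‖λ‖ = ‖ϖ‖`: NO ball is a `2^k · log₂(𝒪_K^×)`** — `{‖y‖ ≤ ‖t‖} ≠ 2^k · log₂(𝒪_K^×)` for all `t`, `k`
(the input of the cell's ball-mover criterion `Thm311RealIsmDHMoverCriterion`: every ball is MOVED).
[cite: NeukirchANT1999, Ch. II Prop. (5.5)] -/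
theorem closedBall_ne_zpow_smul_logUnits (he : absRamificationIdx 2 K = 2) (hf : residueDegree 2 K = 1) {u₀ : K}
    (hu₀ : ‖1 - u₀‖ = ‖(ϖ : K)‖) (hlam : ‖unitLog u₀‖ = ‖(ϖ : K)‖) (t : K) (k : ℤ) :
    closedBall (0 : K) ‖t‖ ≠ ((2 : ℚ_[2]) ^ k) • logUnits K := by
  intro h
  have h2 : ((2 : ℚ_[2]) ^ k) ≠ 0 := zpow_ne_zero _ (by norm_num)
  have hball : ((2 : ℚ_[2]) ^ k)⁻¹ • closedBall (0 : K) ‖t‖ = closedBall 0 (‖((2 : ℚ_[2]) ^ k)⁻¹‖ * ‖t‖) := by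
    rw [smul_closedBall' (inv_ne_zero h2), smul_zero]
  apply logUnits_ne_closedBall hϖ he hf hu₀ hlam (‖((2 : ℚ_[2]) ^ k)⁻¹‖ * ‖t‖)
  rw [← hball, h, smul_smul, inv_mul_cancel₀ h2, one_smul]

end Trichotomy

/-! ## 8. Evaluating `λ`: square roots `ρ² = a`, `a ∈ ℚ₂` -/

section Sqrt

variable [IsUltrametricDist K] [CompleteSpace K]

/-- **`‖log₂ ρ‖ = 4·‖1 − a²‖` when `ρ² = a ∈ ℚ₂` with `‖1 − a²‖ ≤ 1/8`** (`ρ⁴ = a² ∈ 1 + 8ℤ₂` lies in the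
contraction range `‖1 − y‖·2 < 1`, where `‖L(y)‖ = ‖1 − y‖`; and `log₂ ρ = ¼·L(ρ⁴)`).  Valid for every odd
`a ∈ ℤ₂` (`a² ≡ 1 (mod 8)`); no hypothesis on `e`, `f`. [cite: NeukirchANT1999, Ch. II Prop. (5.5)] -/
theorem norm_unitLog_eq_of_sq_eq {ρ : K} {a : ℚ_[2]} (hsq : ρ ^ 2 = algebraMap ℚ_[2] K a)
    (ha : ‖1 - a ^ 2‖ ≤ 8⁻¹) : ‖unitLog ρ‖ = 4 * ‖1 - a ^ 2‖ := by
  have h4 : ρ ^ 4 = algebraMap ℚ_[2] K (a ^ 2) := by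
    rw [show ρ ^ 4 = (ρ ^ 2) ^ 2 by ring, hsq, map_pow]
  have hy : ‖1 - ρ ^ 4‖ = ‖1 - a ^ 2‖ := by
    rw [h4, show (1 : K) - algebraMap ℚ_[2] K (a ^ 2) = algebraMap ℚ_[2] K (1 - a ^ 2) by
      rw [map_sub, map_one], norm_algebraMap']
  have hP : IsPrincipal (ρ ^ 4) := by
    show ‖1 - ρ ^ 4‖ < 1
    rw [hy]; exact ha.trans_lt (by norm_num)
  have hθ : (8⁻¹ : ℝ) * ((2 : ℕ) : ℝ) ^ (1 / (((2 : ℕ) : ℝ) - 1)) ≤ 1 := by norm_num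
  have hcontr := norm_logSeries_add_le 2 K hθ (y := ρ ^ 4) (by rw [hy]; exact ha)
  -- `‖L(ρ⁴)‖ = ‖1 − ρ⁴‖`
  have hL : ‖logSeries (ρ ^ 4)‖ = ‖1 - ρ ^ 4‖ := by
    by_cases h0 : 1 - ρ ^ 4 = 0
    · have h1 : ρ ^ 4 = 1 := (sub_eq_zero.mp h0).symm
      rw [h1, logSeries_one, sub_self]
    · have hlt : ‖logSeries (ρ ^ 4) + (1 - ρ ^ 4)‖ < ‖-(1 - ρ ^ 4)‖ := by
        rw [norm_neg]
        refine hcontr.trans_lt ?_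
        have hpos : 0 < ‖1 - ρ ^ 4‖ := norm_pos_iff.mpr h0
        have h2 : (8⁻¹ : ℝ) * ((2 : ℕ) : ℝ) ^ (1 / (((2 : ℕ) : ℝ) - 1)) = 4⁻¹ := by norm_num
        rw [h2]
        linarith
      have h := IsUltrametricDist.norm_add_eq_max_of_norm_ne_norm hlt.ne
      rw [add_neg_cancel_right, max_eq_right hlt.le, norm_neg] at h
      exact h
  have h4K : ‖((4 : ℕ) : K)⁻¹‖ = 4 := by
    rw [norm_inv, show ((4 : ℕ) : K) = 2 * 2 by norm_num, norm_mul, WildDyadic.norm_two]; norm_num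
  rw [unitLog_eq_inv_mul_logSeries 2 (by norm_num : 0 < 4) hP, norm_mul, h4K, hL, hy]

omit [IsUltrametricDist K] [CompleteSpace K] in
/-- `‖a‖ = 1` and `‖ρ‖ = 1` when `ρ² = a` and `‖1 − a‖ < 1`. [cite: NeukirchANT1999, Ch. II Prop. (5.3)] -/
theorem norm_eq_one_of_sq_eq {ρ : K} {a : ℚ_[2]} (hsq : ρ ^ 2 = algebraMap ℚ_[2] K a) (ha1 : ‖1 - a‖ < 1) :
    ‖a‖ = 1 ∧ ‖ρ‖ = 1 := by
  have ha : ‖a‖ = 1 := by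
    have h := IsUltrametricDist.norm_add_eq_max_of_norm_ne_norm (x := (1 : ℚ_[2])) (y := -(1 - a))
      (by rw [norm_one, norm_neg]; exact ha1.ne')
    rw [norm_one, norm_neg, max_eq_left ha1.le, show (1 : ℚ_[2]) + -(1 - a) = a by ring] at h
    exact h
  refine ⟨ha, ?_⟩
  have h2 : ‖ρ‖ ^ 2 = 1 := by rw [← norm_pow, hsq, norm_algebraMap', ha]
  exact (pow_eq_one_iff_of_nonneg (norm_nonneg ρ) two_ne_zero).mp h2

/-- In `ℚ₂`: a unit `b` has `‖1 − b‖ ≤ 1/2` (`ℤ₂^× = 1 + 2ℤ₂`; campaign-S `residueDegree_padic`,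
`absRamificationIdx_padic`). [cite: NeukirchANT1999, Ch. II Prop. (5.3)] -/
theorem padic_norm_one_sub_le_half {b : ℚ_[2]} (hb : ‖b‖ = 1) : ‖1 - b‖ ≤ 2⁻¹ :=
  UnramifiedDyadic.norm_le_half_of_norm_lt_one (absRamificationIdx_padic 2)
    (WildDyadic.isPrincipal_of_residueDegree_eq_one (residueDegree_padic 2) hb)

variable [ProperSpace K] {ϖ : Kˣ} (hϖ : IsUniformizer ϖ)
include hϖ

omit [CompleteSpace K] in
/-- **`ρ² = a` with `‖1 − a‖ = 1/2` (`a ≡ 3 (mod 4)`) ⇒ `ρ ∈ U_1 ∖ U_2`: `‖1 − ρ‖ = ‖ϖ‖`** (`(1 − ρ)(1 + ρ) = 1 − a`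
has norm `‖ϖ‖²`, and both factors have norm `≤ ‖ϖ‖`). [cite: NeukirchANT1999, Ch. II Prop. (5.5)] -/
theorem norm_one_sub_eq_unif_of_sq_eq (he : absRamificationIdx 2 K = 2) (hf : residueDegree 2 K = 1) {ρ : K}
    {a : ℚ_[2]} (hsq : ρ ^ 2 = algebraMap ℚ_[2] K a) (ha1 : ‖1 - a‖ = 2⁻¹) : ‖1 - ρ‖ = ‖(ϖ : K)‖ := by
  obtain ⟨-, hρ1⟩ := norm_eq_one_of_sq_eq hsq (by rw [ha1]; norm_num)
  have hprod : ‖1 - ρ‖ * ‖1 + ρ‖ = ‖(ϖ : K)‖ ^ 2 := by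
    rw [← norm_mul, show (1 - ρ) * (1 + ρ) = 1 - ρ ^ 2 by ring, hsq,
      show (1 : K) - algebraMap ℚ_[2] K a = algebraMap ℚ_[2] K (1 - a) by rw [map_sub, map_one],
      norm_algebraMap', ha1, norm_unif_sq hϖ he]
  have hle : ‖1 - ρ‖ ≤ ‖(ϖ : K)‖ := norm_one_sub_le_unif hϖ hf hρ1
  have hle' : ‖1 + ρ‖ ≤ ‖(ϖ : K)‖ := norm_one_add_le_unif hϖ he hf hρ1
  rcases hle.lt_or_eq with hlt | heq
  · exfalso
    have h2 : ‖1 - ρ‖ ≤ ‖(ϖ : K)‖ ^ 2 := norm_le_sq_of_norm_lt_unif hϖ hlt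
    have h3 : ‖(ϖ : K)‖ ^ 2 ≤ ‖(ϖ : K)‖ ^ 2 * ‖(ϖ : K)‖ := by
      calc ‖(ϖ : K)‖ ^ 2 = ‖1 - ρ‖ * ‖1 + ρ‖ := hprod.symm
        _ ≤ ‖(ϖ : K)‖ ^ 2 * ‖(ϖ : K)‖ := mul_le_mul h2 hle' (norm_nonneg _) (by positivity)
    have h4 : ‖(ϖ : K)‖ ^ 2 * ‖(ϖ : K)‖ < ‖(ϖ : K)‖ ^ 2 :=
      mul_lt_of_lt_one_right (pow_pos (norm_units_pos ϖ) 2) hϖ.1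
    exact absurd h3 (not_le.mpr h4)
  · exact heq

omit [CompleteSpace K] in
/-- `ρ² = a`, `‖a‖ = 1/2` ⇒ `‖1 − (1 + ρ)‖ = ‖ρ‖ = ‖ϖ‖` (`1 + ρ ∈ U_1 ∖ U_2`). [cite: NeukirchANT1999, Ch. II Prop. (5.5)] -/
theorem norm_one_sub_one_add_eq_unif_of_sq_eq (he : absRamificationIdx 2 K = 2) {ρ : K} {a : ℚ_[2]}
    (hsq : ρ ^ 2 = algebraMap ℚ_[2] K a) (ha : ‖a‖ = 2⁻¹) : ‖1 - (1 + ρ)‖ = ‖(ϖ : K)‖ := by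
  have h : ‖ρ‖ ^ 2 = ‖(ϖ : K)‖ ^ 2 := by rw [← norm_pow, hsq, norm_algebraMap', ha, norm_unif_sq hϖ he]
  rw [show (1 : K) - (1 + ρ) = -ρ by ring, norm_neg]
  exact (pow_left_inj₀ (norm_nonneg _) (norm_nonneg _) two_ne_zero).mp h

/-- **`ρ² = a` with `‖a‖ = 1/2` (`ρ` a uniformizer with square in `ℚ₂`: `ℚ₂(√±2)`, `ℚ₂(√±6)`) ⇒
`‖log₂(1 + ρ)‖ = ‖ϖ‖` EXACTLY.**  With `t = a/2 ∈ ℤ₂^×` (so `‖1 − t‖ ≤ 1/2 < ‖ρ‖`): `(1 + ρ)² = 1 − 2w`,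
`w = −(ρ + t)`, `‖w‖ = 1`, `‖1 + w‖ = ‖(1 − t) − ρ‖ = ‖ϖ‖`, hence `‖2·log₂(1 + ρ)‖ = ‖L(1 − 2w)‖ = ‖2w(1 + w)‖ =
‖ϖ‖³` (the `mod 4` congruence, `‖4‖ = ‖ϖ‖⁴`).  For `a = 2` this is `log₂(1 + √2) ≡ √2 (mod 𝔪²)`.
[cite: NeukirchANT1999, Ch. II Prop. (5.5)] -/
theorem norm_unitLog_one_add_eq_unif_of_sq_eq (he : absRamificationIdx 2 K = 2) {ρ : K} {a : ℚ_[2]}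
    (hsq : ρ ^ 2 = algebraMap ℚ_[2] K a) (ha : ‖a‖ = 2⁻¹) :
    ‖unitLog (1 + ρ)‖ = ‖(ϖ : K)‖ := by
  have h2K : (2 : K) ≠ 0 := by rw [← norm_pos_iff, WildDyadic.norm_two]; norm_num
  have h2Q : (2 : ℚ_[2]) ≠ 0 := by norm_num
  -- `‖ρ‖ = ‖ϖ‖`
  have hρ : ‖ρ‖ = ‖(ϖ : K)‖ := by
    rw [← norm_neg, ← norm_one_sub_one_add_eq_unif_of_sq_eq hϖ he hsq ha, sub_add_cancel_left]
  have hρlt : ‖ρ‖ < 1 := by rw [hρ]; exact hϖ.1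
  -- `t = a/2`, a unit of `ℚ₂` inside `K`, with `ρ² = 2t` and `‖1 − t‖ ≤ 1/2`
  set t : K := algebraMap ℚ_[2] K (a / 2) with htdef
  have hb : ‖a / 2‖ = 1 := by rw [norm_div, ha, WildDyadic.norm_two]; norm_num
  have ht1 : ‖t‖ = 1 := by rw [htdef, norm_algebraMap', hb]
  have hρt : ρ ^ 2 = 2 * t := by
    rw [htdef, hsq, show (2 : K) = algebraMap ℚ_[2] K 2 from (map_ofNat _ 2).symm, ← map_mul,
      mul_div_cancel₀ a h2Q]
  have h1t : ‖1 - t‖ < ‖ρ‖ := by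
    rw [htdef, show (1 : K) - algebraMap ℚ_[2] K (a / 2) = algebraMap ℚ_[2] K (1 - a / 2) by
      rw [map_sub, map_one], norm_algebraMap', hρ]
    exact (padic_norm_one_sub_le_half hb).trans_lt (half_lt_norm_unif hϖ he)
  -- `w = −(ρ + t)`: `‖w‖ = 1`, `‖1 + w‖ = ‖ϖ‖`, `(1 + ρ)² = 1 − 2w`
  set w : K := -(ρ + t) with hwdef
  have hw1 : ‖w‖ = 1 := by
    rw [hwdef, norm_neg, IsUltrametricDist.norm_add_eq_max_of_norm_ne_norm (by rw [ht1]; exact hρlt.ne),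
      ht1, max_eq_right hρlt.le]
  have h1w : ‖1 + w‖ = ‖(ϖ : K)‖ := by
    rw [hwdef, show (1 : K) + -(ρ + t) = -ρ + (1 - t) by ring,
      IsUltrametricDist.norm_add_eq_max_of_norm_ne_norm (by rw [norm_neg]; exact h1t.ne'), norm_neg,
      max_eq_left h1t.le, hρ]
  have hsq' : (1 + ρ) ^ 2 = 1 - 2 * w := by
    rw [hwdef, show (1 + ρ) ^ 2 = 1 + 2 * ρ + ρ ^ 2 by ring, hρt]; ring
  -- `‖L(1 − 2w)‖ = ‖2w(1+w)‖ = ‖ϖ‖³ > 1/4`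
  have hmain : ‖(2 : K) * w * (1 + w)‖ = ‖(ϖ : K)‖ ^ 3 := by
    rw [norm_mul, norm_mul, hw1, mul_one, h1w, ← norm_unif_sq_eq_norm_two hϖ he]; ring
  have hq := UnramifiedDyadic.norm_logSeries_add_le_quarter (K := K) hw1.le
  have hlt : ‖logSeries (1 - 2 * w) + 2 * w * (1 + w)‖ < ‖-((2 : K) * w * (1 + w))‖ := by
    rw [norm_neg, hmain]; exact hq.trans_lt (quarter_lt_norm_unif_pow_three hϖ he)
  have hL : ‖logSeries (1 - 2 * w)‖ = ‖(ϖ : K)‖ ^ 3 := by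
    have h := IsUltrametricDist.norm_add_eq_max_of_norm_ne_norm hlt.ne
    rw [add_neg_cancel_right, max_eq_right hlt.le, norm_neg, hmain] at h
    exact h
  -- `2·log₂(1+ρ) = log₂((1+ρ)²) = L(1 − 2w)`
  have hu1 : ‖1 + ρ‖ = 1 := by
    rw [IsUltrametricDist.norm_add_eq_max_of_norm_ne_norm (by rw [norm_one]; exact hρlt.ne'), norm_one,
      max_eq_left hρlt.le]
  have hP : IsPrincipal (1 - 2 * w) := by
    show ‖1 - (1 - 2 * w)‖ < 1
    rw [sub_sub_cancel, norm_mul, WildDyadic.norm_two, hw1]; norm_num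
  have h2log : (2 : K) * unitLog (1 + ρ) = logSeries (1 - 2 * w) := by
    have h := unitLog_pow 2 hu1 2
    rw [hsq', unitLog_of_isPrincipal 2 hP, Nat.cast_ofNat] at h
    exact h.symm
  have h := congrArg (‖·‖) h2log
  simp only [norm_mul, hL, ← norm_unif_sq_eq_norm_two hϖ he] at h
  rw [show ‖(ϖ : K)‖ ^ 3 = ‖(ϖ : K)‖ ^ 2 * ‖(ϖ : K)‖ by ring] at h
  exact mul_left_cancel₀ (pow_ne_zero 2 (norm_units_pos ϖ).ne') h

end Sqrt

/-! ## 9. The three cases at `ρ² = a` -/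

section Cases

variable [IsUltrametricDist K] [CompleteSpace K] [ProperSpace K]

/-- **[ℚ₂(√±2), ℚ₂(√±6)]  `e = 2`, `f = 1`, `K ∋ ρ` with `ρ² = a ∈ ℚ₂`, `‖a‖ = 1/2`: `log₂(𝒪_K^×) =
𝔪³ ∪ (log₂(1 + ρ) + 𝔪³)` with `‖log₂(1 + ρ)‖ = ‖ϖ‖`** — NOT an `𝒪_K`-submodule.
[cite: NeukirchANT1999, Ch. II Prop. (5.5)] -/
theorem logUnits_eq_union_of_norm_eq_half {ϖ : Kˣ} (hϖ : IsUniformizer ϖ) (he : absRamificationIdx 2 K = 2)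
    (hf : residueDegree 2 K = 1) {ρ : K} {a : ℚ_[2]} (hsq : ρ ^ 2 = algebraMap ℚ_[2] K a) (ha : ‖a‖ = 2⁻¹) :
    logUnits K = closedBall (0 : K) (‖(ϖ : K)‖ ^ 3) ∪ closedBall (unitLog (1 + ρ)) (‖(ϖ : K)‖ ^ 3) ∧
      ‖unitLog (1 + ρ)‖ = ‖(ϖ : K)‖ := by
  have hρ := norm_one_sub_one_add_eq_unif_of_sq_eq hϖ he hsq ha
  exact ⟨logUnits_eq_union hϖ he hf hρ, norm_unitLog_one_add_eq_unif_of_sq_eq hϖ he hsq ha⟩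

/-- **[ℚ₂(√±2), ℚ₂(√±6)]  NO ball is a `2^k · log₂(𝒪_K^×)`**: `{‖y‖ ≤ ‖t‖} ≠ 2^k · log₂(𝒪_K^×)` for every `t`
and `k` — by the cell's ball-mover criterion, Dupuy–Hilado's (Ind2) moves EVERY ball at such a place.
[cite: NeukirchANT1999, Ch. II Prop. (5.5)] -/
theorem closedBall_ne_zpow_smul_logUnits_of_norm_eq_half (he : absRamificationIdx 2 K = 2)
    (hf : residueDegree 2 K = 1) {ρ : K} {a : ℚ_[2]} (hsq : ρ ^ 2 = algebraMap ℚ_[2] K a) (ha : ‖a‖ = 2⁻¹)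
    (t : K) (k : ℤ) : closedBall (0 : K) ‖t‖ ≠ ((2 : ℚ_[2]) ^ k) • logUnits K := by
  obtain ⟨ϖ, hϖ⟩ := exists_isUniformizer (F := K)
  have hρ := norm_one_sub_one_add_eq_unif_of_sq_eq hϖ he hsq ha
  exact closedBall_ne_zpow_smul_logUnits hϖ he hf hρ (norm_unitLog_one_add_eq_unif_of_sq_eq hϖ he hsq ha) t k

/-- **[ℚ₂(√±2), ℚ₂(√±6)]  unit multiples: for `‖w‖ = 1`, `w · log₂(𝒪_K^×) = log₂(𝒪_K^×) ↔ ‖1 − w‖ ≤ ‖2‖`**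
(the unit stabiliser is EXACTLY `1 + 2𝒪_K`; e.g. `(1 + ρ) · log₂(𝒪_K^×) ≠ log₂(𝒪_K^×)` — abc-iut-w5-d039's
`(1 + √2)·I_v ≠ I_v`). [cite: NeukirchANT1999, Ch. II Prop. (5.5)] -/
theorem smul_logUnits_eq_iff_of_norm_eq_half (he : absRamificationIdx 2 K = 2) (hf : residueDegree 2 K = 1)
    {ρ : K} {a : ℚ_[2]} (hsq : ρ ^ 2 = algebraMap ℚ_[2] K a) (ha : ‖a‖ = 2⁻¹) {w : K} (hw : ‖w‖ = 1) :
    w • logUnits K = logUnits K ↔ ‖1 - w‖ ≤ ‖(2 : K)‖ := by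
  obtain ⟨ϖ, hϖ⟩ := exists_isUniformizer (F := K)
  obtain ⟨-, hlam⟩ := logUnits_eq_union_of_norm_eq_half hϖ he hf hsq ha
  have hρ := norm_one_sub_one_add_eq_unif_of_sq_eq hϖ he hsq ha
  rw [← norm_unif_sq_eq_norm_two hϖ he]
  exact smul_logUnits_eq_iff hϖ he hf hρ hlam hw

/-- **[ℚ₂(√±2), ℚ₂(√±6)]  a UNIT `w` (namely `1 + ρ`) with `w · log₂(𝒪_K^×) ≠ log₂(𝒪_K^×)`.**
[cite: NeukirchANT1999, Ch. II Prop. (5.5)] -/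
theorem one_add_smul_logUnits_ne_of_norm_eq_half (he : absRamificationIdx 2 K = 2) (hf : residueDegree 2 K = 1)
    {ρ : K} {a : ℚ_[2]} (hsq : ρ ^ 2 = algebraMap ℚ_[2] K a) (ha : ‖a‖ = 2⁻¹) :
    ‖1 + ρ‖ = 1 ∧ (1 + ρ) • logUnits K ≠ logUnits K := by
  obtain ⟨ϖ, hϖ⟩ := exists_isUniformizer (F := K)
  have hρ := norm_one_sub_one_add_eq_unif_of_sq_eq hϖ he hsq ha
  have hu1 : ‖1 + ρ‖ = 1 := IsPrincipal.norm_eq_one (show ‖1 - (1 + ρ)‖ < 1 by rw [hρ]; exact hϖ.1)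
  refine ⟨hu1, fun h => ?_⟩
  have h2 := (smul_logUnits_eq_iff_of_norm_eq_half he hf hsq ha hu1).mp h
  rw [hρ, ← norm_unif_sq_eq_norm_two hϖ he, sq] at h2
  exact absurd h2 (not_le.mpr (mul_lt_of_lt_one_left (norm_units_pos ϖ) hϖ.1))

/-- **[ℚ₂(√3) = ℚ₂(√−5)]  `e = 2`, `f = 1`, `K ∋ ρ` with `ρ² = a ∈ ℚ₂`, `‖1 − a‖ = 1/2`, `‖1 + a‖ = 1/4`
(`a ≡ 3 (mod 8)`): `log₂(𝒪_K^×) = 𝔪² = {‖y‖ ≤ ‖ϖ‖²}`** — a ball (`‖log₂ ρ‖ = 4·‖1 − a²‖ = 1/2`); by the cell's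
criterion the ball `𝔪^j` is (Ind2)-fixed iff `j` is EVEN: the unit ball `𝒪_K` IS fixed.
[cite: NeukirchANT1999, Ch. II Prop. (5.5)] -/
theorem logUnits_eq_closedBall_sq_of_sq_eq {ϖ : Kˣ} (hϖ : IsUniformizer ϖ) (he : absRamificationIdx 2 K = 2)
    (hf : residueDegree 2 K = 1) {ρ : K} {a : ℚ_[2]} (hsq : ρ ^ 2 = algebraMap ℚ_[2] K a)
    (ha1 : ‖1 - a‖ = 2⁻¹) (ha2 : ‖1 + a‖ = 4⁻¹) : logUnits K = closedBall (0 : K) (‖(ϖ : K)‖ ^ 2) := by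
  have hsq2 : ‖1 - a ^ 2‖ = 8⁻¹ := by
    rw [show (1 : ℚ_[2]) - a ^ 2 = (1 - a) * (1 + a) by ring, norm_mul, ha1, ha2]; norm_num
  have hlam : ‖unitLog ρ‖ = ‖(ϖ : K)‖ ^ 2 := by
    rw [norm_unitLog_eq_of_sq_eq hsq hsq2.le, hsq2, norm_unif_sq hϖ he]; norm_num
  exact logUnits_eq_closedBall_of_norm_unitLog_eq_sq hϖ he hf (norm_one_sub_eq_unif_of_sq_eq hϖ he hf hsq ha1) hlam

/-- … the same ball with radius `‖2‖`: `log₂(𝒪_K^×) = 2𝒪_K = {‖y‖ ≤ ‖2‖}` (no uniformizer in the statement).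
[cite: NeukirchANT1999, Ch. II Prop. (5.5)] -/
theorem logUnits_eq_closedBall_norm_two_of_sq_eq (he : absRamificationIdx 2 K = 2) (hf : residueDegree 2 K = 1)
    {ρ : K} {a : ℚ_[2]} (hsq : ρ ^ 2 = algebraMap ℚ_[2] K a) (ha1 : ‖1 - a‖ = 2⁻¹) (ha2 : ‖1 + a‖ = 4⁻¹) :
    logUnits K = closedBall (0 : K) ‖(2 : K)‖ := by
  obtain ⟨ϖ, hϖ⟩ := exists_isUniformizer (F := K)
  rw [logUnits_eq_closedBall_sq_of_sq_eq hϖ he hf hsq ha1 ha2, norm_unif_sq_eq_norm_two hϖ he]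

/-- **[ℚ₂(√−1) = ℚ₂(√7)]  `e = 2`, `f = 1`, `K ∋ ρ` with `ρ² = a ∈ ℚ₂`, `‖1 − a‖ = 1/2`, `‖1 + a‖ ≤ 1/8`
(`a ≡ 7 (mod 8)`): `log₂(𝒪_K^×) = 𝔪³ = {‖y‖ ≤ ‖ϖ‖³}`** — a ball (by the cell's criterion `𝔪^j` is (Ind2)-fixed
iff `j` is ODD: the unit ball is MOVED, `𝔪` is fixed); `‖log₂ ρ‖ ≤ 1/4` (for `a = −1`, `log₂ ρ = 0`).
[cite: NeukirchANT1999, Ch. II Prop. (5.5)] -/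
theorem logUnits_eq_closedBall_cube_of_sq_eq {ϖ : Kˣ} (hϖ : IsUniformizer ϖ) (he : absRamificationIdx 2 K = 2)
    (hf : residueDegree 2 K = 1) {ρ : K} {a : ℚ_[2]} (hsq : ρ ^ 2 = algebraMap ℚ_[2] K a)
    (ha1 : ‖1 - a‖ = 2⁻¹) (ha2 : ‖1 + a‖ ≤ 8⁻¹) : logUnits K = closedBall (0 : K) (‖(ϖ : K)‖ ^ 3) := by
  have hsq2 : ‖1 - a ^ 2‖ ≤ 16⁻¹ := by
    rw [show (1 : ℚ_[2]) - a ^ 2 = (1 - a) * (1 + a) by ring, norm_mul, ha1]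
    calc (2⁻¹ : ℝ) * ‖1 + a‖ ≤ 2⁻¹ * 8⁻¹ := by gcongr
      _ = 16⁻¹ := by norm_num
  have hlam : ‖unitLog ρ‖ ≤ ‖(ϖ : K)‖ ^ 3 := by
    rw [norm_unitLog_eq_of_sq_eq hsq (hsq2.trans (by norm_num))]
    calc (4 : ℝ) * ‖1 - a ^ 2‖ ≤ 4 * 16⁻¹ := by gcongr
      _ = 4⁻¹ := by norm_num
      _ ≤ ‖(ϖ : K)‖ ^ 3 := (quarter_lt_norm_unif_pow_three hϖ he).le
  exact logUnits_eq_closedBall_of_norm_unitLog_le hϖ he hf (norm_one_sub_eq_unif_of_sq_eq hϖ he hf hsq ha1) hlam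

end Cases

end WildQuadraticDyadic

end Literature.IUT.LogVolume

end
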